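import Mathlib.Topology.Algebra.ClopenNhdofOne
import Literature.AnabelianGeometry.SemiGraphs.CommensurabilityProofs4
import Literature.AnabelianGeometry.SemiGraphs.UniversalProCovering

/-!
# Proof of [SemiAnbd] Remark 2.2.1 (as typed in `UniversalProCovering.lean`)

Mochizuki, *Semi-graphs of anabelioids*, Publ. RIMS **42** (2006) 221–322, §2, Remark 2.2.1, p. 24
[cite: MochizukiSemiAnbd2006, Rem. 2.2.1 p.24].  We DISCHARGE the named fact
`SemiGraphOfAnabelioids.remark_2_2_1`: the image of `Π_v → Π_𝒢` (resp. `Π_b → Π_𝒢`) equals the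
stabilizer `⋂_N (image)·N` (`N` open normal) of the compatible system of vertices (resp. edges)
it determines.  Proof: `π₁(φ) : Aut F → Aut (φ^* ⋙ F)` is continuous for Mathlib's profinite
topologies (`continuous_pi1Map` of `CommensurabilityProofs4.lean`), so the image
of the compact group `Π_v` (resp. `Π_b`) is compact, hence closed in the Hausdorff group `Π_𝒢`;
and a closed subgroup `K` of a profinite group satisfies `⋂_N K·N = K`, open normal subgroups
being a basis of neighbourhoods of `1`.
-/

namespace Literature.AnabelianGeometry.SemiGraphs

open CategoryTheory CategoryTheory.PreGaloisCategory
open Literature.AnabelianGeometry.Anabelioids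
open scoped Pointwise

universe v₁ u₁

/-- In a profinite group, a closed subgroup `K` is the intersection of the open subgroups `K·N`,
`N` open normal ("stabilizer of a compatible system" = the subgroup itself). [folklore] -/
private theorem proStabilizer_eq_of_isClosed {Γ : Type*} [Group Γ] [TopologicalSpace Γ]
    [IsTopologicalGroup Γ] [CompactSpace Γ] [TotallyDisconnectedSpace Γ]
    (K : Subgroup Γ) (hK : IsClosed (K : Set Γ)) :
    SemiGraphOfAnabelioids.proStabilizer K = K := by
  apply le_antisymm
  · intro x hx
    by_contra hxK
    -- the compact set `K⁻¹ x` misses `1`; choose an open normal `N` missing it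
    have hcpt : IsCompact ((fun k : Γ => k⁻¹ * x) '' (K : Set Γ)) :=
      (hK.isCompact).image (by fun_prop)
    have h1 : (1 : Γ) ∉ (fun k : Γ => k⁻¹ * x) '' (K : Set Γ) := by
      rintro ⟨k, hk, h⟩
      apply hxK
      have : x = k := by
        have := congrArg (fun y => k * y) h
        simpa [mul_assoc] using this
      rw [this]
      exact hk
    obtain ⟨N, hN⟩ := ProfiniteGrp.exist_openNormalSubgroup_sub_open_nhds_of_one
      hcpt.isClosed.isOpen_compl h1
    have hxN : x ∈ ((K ⊔ (N : Subgroup Γ) : Subgroup Γ) : Set Γ) :=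
      (Subgroup.mem_iInf.mp hx) N
    rw [Subgroup.mul_normal] at hxN
    obtain ⟨k, hk, n, hn, rfl⟩ := hxN
    have : (n : Γ) ∈ (fun k' : Γ => k'⁻¹ * (k * n)) '' (K : Set Γ) := ⟨k, hk, by simp⟩
    exact hN hn this
  · exact le_iInf fun N => le_sup_left

/-- The range of a continuous homomorphism from a compact group into a Hausdorff group is closed.
[folklore] -/
private theorem isClosed_range_of_continuous {A B : Type*} [Group A] [TopologicalSpace A] [CompactSpace A]
    [Group B] [TopologicalSpace B] [T2Space B] (f : A →* B) (hf : Continuous f) :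
    IsClosed (f.range : Set B) := by
  have : (f.range : Set B) = Set.range f := by
    ext
    simp
  rw [this]
  exact (isCompact_range hf).isClosed

/-- NAMED FACT `remark_2_2_1` ([SemiAnbd] Remark 2.2.1, p. 24), PROVED.
[cite: MochizukiSemiAnbd2006, Rem. 2.2.1 p.24] -/
theorem SemiGraphOfAnabelioids.remark_2_2_1_holds : SemiGraphOfAnabelioids.remark_2_2_1.{v₁, u₁} := by
  intro 𝒢 _
  refine ⟨fun v F _ => ?_, fun b v h F _ => ?_⟩
  · exact proStabilizer_eq_of_isClosed _
      (isClosed_range_of_continuous _ (continuous_pi1Map (𝒢.ρ v) F))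
  · exact proStabilizer_eq_of_isClosed _
      (isClosed_range_of_continuous _
        ((continuous_pi1Map (𝒢.ρ v) _).comp (continuous_pi1Map (𝒢.pull b v h).pullback F)))

end Literature.AnabelianGeometry.SemiGraphs
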